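import Summits.QuantumFields.YangMills.Theorems.LuscherReductionTwistedTraceScalingBOStiffFlatQuasimode
import Summits.QuantumFields.YangMills.Theorems.LuscherReductionTwistedTraceScalingBOStiffFlatTruncation
import HarnessLib

/-!
# (B-ST) (W1-10 (A2)+(A3) in flat coordinates) `…BOStiffSliceModel`: the flat slice integral over the weighted profile ball is two-sided `(1 − tails)·Λ ≤ ∫_S ≤ Λ`, `Λ·e^{−Σcx²}` exact
# (lane A of S-BASE, crux `TwistedTraceScaling` stmt-QuantumFields-20203, C4-CORE, the (B-ST) pen; (A) split, flat model for the lead's `flatVec` coordinates)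

Flat coordinates `(y,z) ∈ (σ → ℝ) × Z`, data `ãᵢ ≥ 0`, `b̃ᵢ > 0`, `cᵢ ≥ 0`, `cᵢ² = ãᵢ²+2ãᵢb̃ᵢ`, gauge width `s > 0`; integrand
`F_x(y,z) = Πᵢ[e^{−ãᵢxᵢ²}e^{−b̃ᵢ(xᵢ−yᵢ)²}e^{−ãᵢyᵢ²}e^{−cᵢyᵢ²}]·e^{−‖z‖²/s²} ≥ 0` with exact total `Λ·e^{−Σcᵢxᵢ²}`, `Λ = Πᵢ√(π/(ãᵢ+b̃ᵢ+cᵢ))·(πs²)^{dim Z/2}` (✓`integral_flatKernel_profile_prod`).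
* ★ `sliceModel_upper` — for every measurable `S`: `∫_S F_x ≤ Λ·e^{−Σcᵢxᵢ²}`;
* ★★ `sliceModel_lower` — for the weighted ball `S = {Σwᵢyᵢ² + ‖z‖² ≤ r²}` (`wᵢ ≥ 0`), a centre with `Σwᵢxᵢ² ≤ r²/8` and `θ > 0` with `θwᵢ ≤ (ãᵢ+b̃ᵢ+cᵢ)/2`:
  `(1 − (√2)^{|σ|}e^{−θr²/4} − e^{−r²/(8s²)}·2^{dim Z/2})·Λ·e^{−Σcᵢxᵢ²} ≤ ∫_S F_x`
  (completed square per mode ✓`flatKernel_profile_pi_eq`, `Sᶜ ⊆ {Σwᵢ(yᵢ−mᵢxᵢ)² > r²/4} ∪ {‖z‖² > r²/4}` since `mᵢ ∈ [0,1]`, Chernoff ✓`integral_indicator_prodGauss_le` after the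
  translation `u = y − m·x`, gauge tail ✓`integral_indicator_gauss_le`).
HONEST FRAMING: Gaussian algebra for a stub of a child of the CONDITIONAL route R2b1; (Q±) OPEN; (B-ST), C4-CORE OPEN; not infinite volume, not a gap, not Clay.
-/

set_option autoImplicit false

noncomputable section

open MeasureTheory Filter Topology Real
open scoped BigOperators

namespace Summit.QuantumFields.YangMills.Theorems.FemtoTransferGap.TwoLattice.ConstTube

open Literature.Analysis.OperatorTheory.GaussianTransferKernel

section Slice

variable {σ : Type*} [Fintype σ] {Z : Type*} [NormedAddCommGroup Z] [InnerProductSpace ℝ Z] [FiniteDimensional ℝ Z] [MeasurableSpace Z] [BorelSpace Z]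

omit [InnerProductSpace ℝ Z] [FiniteDimensional ℝ Z] [MeasurableSpace Z] [BorelSpace Z] in
/-- The flat integrand is nonnegative. [folklore] -/
theorem flatIntegrand_nonneg (a b c x : σ → ℝ) (s : ℝ) (p : (σ → ℝ) × Z) :
    0 ≤ (∏ i, Real.exp (-(a i * x i ^ 2)) * Real.exp (-(b i * (x i - p.1 i) ^ 2)) * Real.exp (-(a i * p.1 i ^ 2)) * Real.exp (-(c i * p.1 i ^ 2))) *
      Real.exp (-(‖p.2‖ ^ 2 / s ^ 2)) :=
  mul_nonneg (Finset.prod_nonneg fun i _ => by positivity) (Real.exp_pos _).le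

omit [InnerProductSpace ℝ Z] [FiniteDimensional ℝ Z] in
/-- The flat integrand is measurable. [folklore] -/
theorem measurable_flatIntegrand (a b c x : σ → ℝ) (s : ℝ) :
    Measurable fun p : (σ → ℝ) × Z => (∏ i, Real.exp (-(a i * x i ^ 2)) * Real.exp (-(b i * (x i - p.1 i) ^ 2)) * Real.exp (-(a i * p.1 i ^ 2)) *
      Real.exp (-(c i * p.1 i ^ 2))) * Real.exp (-(‖p.2‖ ^ 2 / s ^ 2)) := by
  refine (Finset.measurable_prod _ fun i _ => ?_).mul (Real.measurable_exp.comp ((measurable_snd.norm.pow_const 2).div_const _).neg)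
  have hyi : Measurable fun p : (σ → ℝ) × Z => p.1 i := (measurable_pi_apply i).comp measurable_fst
  exact ((measurable_const.mul (Real.measurable_exp.comp ((measurable_const.mul ((measurable_const.sub hyi).pow_const 2))).neg)).mul
    (Real.measurable_exp.comp ((measurable_const.mul (hyi.pow_const 2))).neg)).mul (Real.measurable_exp.comp ((measurable_const.mul (hyi.pow_const 2))).neg)

/-- ★ **Upper slice bound**: for every measurable `S`, `∫_S F_x ≤ Λ·e^{−Σcᵢxᵢ²}`. [cite: Wipf2021, §8.5.1 (8.56)–(8.57)] -/
theorem sliceModel_upper {a b c : σ → ℝ} (ha : ∀ i, 0 ≤ a i) (hb : ∀ i, 0 < b i) (hc0 : ∀ i, 0 ≤ c i) (hc : ∀ i, c i ^ 2 = a i ^ 2 + 2 * a i * b i)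
    {s : ℝ} (hs : 0 < s) (x : σ → ℝ) (S : Set ((σ → ℝ) × Z)) :
    ∫ p in S, (∏ i, Real.exp (-(a i * x i ^ 2)) * Real.exp (-(b i * (x i - p.1 i) ^ 2)) * Real.exp (-(a i * p.1 i ^ 2)) * Real.exp (-(c i * p.1 i ^ 2))) *
        Real.exp (-(‖p.2‖ ^ 2 / s ^ 2)) ∂((volume : Measure (σ → ℝ)).prod (volume : Measure Z)) ≤
      (∏ i, Real.sqrt (π / (a i + b i + c i))) * (π * s ^ 2) ^ ((Module.finrank ℝ Z : ℝ) / 2) * Real.exp (-(∑ i, c i * x i ^ 2)) := by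
  have hval := integral_flatKernel_profile_prod (Z := Z) ha hb hc0 hc hs x
  have hpos : 0 < (∏ i, Real.sqrt (π / (a i + b i + c i))) * (π * s ^ 2) ^ ((Module.finrank ℝ Z : ℝ) / 2) * Real.exp (-(∑ i, c i * x i ^ 2)) := by
    refine mul_pos (mul_pos (Finset.prod_pos fun i _ => Real.sqrt_pos.mpr (div_pos pi_pos (by linarith [ha i, hb i, hc0 i]))) (by positivity)) (Real.exp_pos _)
  have hint : Integrable (fun p : (σ → ℝ) × Z => (∏ i, Real.exp (-(a i * x i ^ 2)) * Real.exp (-(b i * (x i - p.1 i) ^ 2)) * Real.exp (-(a i * p.1 i ^ 2)) *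
      Real.exp (-(c i * p.1 i ^ 2))) * Real.exp (-(‖p.2‖ ^ 2 / s ^ 2))) ((volume : Measure (σ → ℝ)).prod (volume : Measure Z)) :=
    Integrable.of_integral_ne_zero (by rw [hval]; exact hpos.ne')
  rw [← hval]
  exact setIntegral_le_integral hint (ae_of_all _ fun p => flatIntegrand_nonneg a b c x s p)


omit [InnerProductSpace ℝ Z] [FiniteDimensional ℝ Z] in
/-- The weighted ball `{Σwᵢyᵢ² + ‖z‖² ≤ r²}` is measurable. [folklore] -/
theorem measurableSet_weightedBall' (w : σ → ℝ) (r : ℝ) : MeasurableSet {p : (σ → ℝ) × Z | ∑ i, w i * p.1 i ^ 2 + ‖p.2‖ ^ 2 ≤ r ^ 2} :=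
  measurableSet_le ((Finset.measurable_sum _ fun i _ => measurable_const.mul (((measurable_pi_apply i).comp measurable_fst).pow_const 2)).add
    (measurable_snd.norm.pow_const 2)) measurable_const

set_option maxHeartbeats 1600000 in
-- long Gaussian bookkeeping.
/-- ★★ **Lower slice bound on the weighted profile ball** (see the module docstring). [cite: Wipf2021, §8.5.1 (8.56)–(8.57)] -/
theorem sliceModel_lower {a b c : σ → ℝ} (ha : ∀ i, 0 ≤ a i) (hb : ∀ i, 0 < b i) (hc0 : ∀ i, 0 ≤ c i) (hc : ∀ i, c i ^ 2 = a i ^ 2 + 2 * a i * b i)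
    {s : ℝ} (hs : 0 < s) {w : σ → ℝ} (hw : ∀ i, 0 ≤ w i) {θ : ℝ} (hθ : 0 < θ) (hθw : ∀ i, θ * w i ≤ (a i + b i + c i) / 2) {r : ℝ}
    {x : σ → ℝ} (hx : ∑ i, w i * x i ^ 2 ≤ r ^ 2 / 8) :
    (1 - Real.sqrt 2 ^ Fintype.card σ * Real.exp (-(θ * (r ^ 2 / 4))) - Real.exp (-(r ^ 2 / 4 / (2 * s ^ 2))) * (2 : ℝ) ^ ((Module.finrank ℝ Z : ℝ) / 2)) *
        ((∏ i, Real.sqrt (π / (a i + b i + c i))) * (π * s ^ 2) ^ ((Module.finrank ℝ Z : ℝ) / 2) * Real.exp (-(∑ i, c i * x i ^ 2))) ≤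
      ∫ p in {p : (σ → ℝ) × Z | ∑ i, w i * p.1 i ^ 2 + ‖p.2‖ ^ 2 ≤ r ^ 2},
        (∏ i, Real.exp (-(a i * x i ^ 2)) * Real.exp (-(b i * (x i - p.1 i) ^ 2)) * Real.exp (-(a i * p.1 i ^ 2)) * Real.exp (-(c i * p.1 i ^ 2))) *
          Real.exp (-(‖p.2‖ ^ 2 / s ^ 2)) ∂((volume : Measure (σ → ℝ)).prod (volume : Measure Z)) := by
  -- names
  have hsi : ∀ i, 0 < a i + b i + c i := fun i => by linarith [ha i, hb i, hc0 i]
  set m : σ → ℝ := fun i => b i / (a i + b i + c i) with hm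
  have hm0 : ∀ i, 0 ≤ m i := fun i => div_nonneg (hb i).le (hsi i).le
  have hm1 : ∀ i, m i ≤ 1 := fun i => by rw [hm]; exact (div_le_one (hsi i)).mpr (by linarith [ha i, hc0 i])
  set E : ℝ := Real.exp (-(∑ i, c i * x i ^ 2)) with hE
  set Pf : (σ → ℝ) → ℝ := fun y => ∏ i, Real.exp (-(a i * x i ^ 2)) * Real.exp (-(b i * (x i - y i) ^ 2)) * Real.exp (-(a i * y i ^ 2)) * Real.exp (-(c i * y i ^ 2)) with hPf
  set G : Z → ℝ := fun z => Real.exp (-(‖z‖ ^ 2 / s ^ 2)) with hG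
  set Λs : ℝ := ∏ i, Real.sqrt (π / (a i + b i + c i)) with hΛs
  set Λg : ℝ := (π * s ^ 2) ^ ((Module.finrank ℝ Z : ℝ) / 2) with hΛg
  set S : Set ((σ → ℝ) × Z) := {p | ∑ i, w i * p.1 i ^ 2 + ‖p.2‖ ^ 2 ≤ r ^ 2} with hSdef
  set A : Set (σ → ℝ) := {y | r ^ 2 / 4 < ∑ i, w i * (y i - m i * x i) ^ 2} with hAdef
  set B : Set Z := {z | r ^ 2 / 4 < ‖z‖ ^ 2} with hBdef
  have hS : MeasurableSet S := measurableSet_weightedBall' w r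
  have hAm : MeasurableSet A := measurableSet_lt measurable_const (Finset.measurable_sum _ fun i _ => measurable_const.mul (((measurable_pi_apply i).sub measurable_const).pow_const 2))
  have hBm : MeasurableSet B := measurableSet_lt measurable_const (measurable_norm.pow_const 2)
  -- completed square: `Pf y = E · Π e^{−sᵢ(yᵢ − mᵢxᵢ)²}`
  have hcs : ∀ y, Pf y = E * ∏ i, Real.exp (-((a i + b i + c i) * (y i - m i * x i) ^ 2)) := fun y => by
    rw [hPf, hE]; exact flatKernel_profile_pi_eq hc (fun i => (hsi i).ne') x y
  -- the values
  have hPf_int : ∫ y, Pf y = Λs * E := by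
    rw [hPf, hΛs, hE, integral_flatKernel_profile_pi ha hb hc0 hc x, prod_exp_neg_eq]
  have hG_int : ∫ z, G z = Λg := by rw [hG, hΛg]; exact integral_gauge_gaussian hs
  have hE0 : 0 < E := Real.exp_pos _
  have hΛs0 : 0 < Λs := Finset.prod_pos fun i _ => Real.sqrt_pos.mpr (div_pos pi_pos (hsi i))
  have hΛg0 : 0 < Λg := by rw [hΛg]; positivity
  have hPf0 : ∀ y, 0 ≤ Pf y := fun y => Finset.prod_nonneg fun i _ => by positivity
  have hG0 : ∀ z, 0 ≤ G z := fun z => (Real.exp_pos _).le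
  have hPfm : Measurable Pf := Finset.measurable_prod _ fun i _ =>
    ((measurable_const.mul (Real.measurable_exp.comp ((measurable_const.mul ((measurable_const.sub (measurable_pi_apply i)).pow_const 2))).neg)).mul
      (Real.measurable_exp.comp ((measurable_const.mul ((measurable_pi_apply i).pow_const 2))).neg)).mul (Real.measurable_exp.comp ((measurable_const.mul ((measurable_pi_apply i).pow_const 2))).neg)
  have hGm : Measurable G := Real.measurable_exp.comp ((measurable_norm.pow_const 2).div_const _).neg
  have hPfi : Integrable Pf := Integrable.of_integral_ne_zero (by rw [hPf_int]; positivity)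
  have hGi : Integrable G := Integrable.of_integral_ne_zero (by rw [hG_int]; positivity)
  have hFi : Integrable (fun p : (σ → ℝ) × Z => Pf p.1 * G p.2) ((volume : Measure (σ → ℝ)).prod volume) := hPfi.mul_prod hGi
  -- geometry: off `S`, either the stiff part is far from the contracted centre or the gauge part is large
  have hgeo : ∀ p : (σ → ℝ) × Z, p ∉ S → p.1 ∈ A ∨ p.2 ∈ B := fun p hp => by
    by_contra hnot
    push Not at hnot
    obtain ⟨hA', hB'⟩ := hnot
    have h1 : ∑ i, w i * (p.1 i - m i * x i) ^ 2 ≤ r ^ 2 / 4 := not_lt.mp hA'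
    have h2 : ‖p.2‖ ^ 2 ≤ r ^ 2 / 4 := not_lt.mp hB'
    apply hp
    show ∑ i, w i * p.1 i ^ 2 + ‖p.2‖ ^ 2 ≤ r ^ 2
    have h3 : ∑ i, w i * p.1 i ^ 2 ≤ ∑ i, (2 * (w i * (p.1 i - m i * x i) ^ 2) + 2 * (w i * x i ^ 2)) := by
      refine Finset.sum_le_sum fun i _ => ?_
      have hm2 : (m i * x i) ^ 2 ≤ x i ^ 2 := by
        rw [mul_pow]; exact mul_le_of_le_one_left (sq_nonneg _) (by nlinarith [hm0 i, hm1 i])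
      nlinarith [hw i, sq_nonneg (p.1 i - 2 * m i * x i), mul_nonneg (hw i) (sq_nonneg (p.1 i - m i * x i - m i * x i)), mul_le_mul_of_nonneg_left hm2 (hw i)]
    rw [Finset.sum_add_distrib, ← Finset.mul_sum, ← Finset.mul_sum] at h3
    linarith
  -- the complement integral
  have hcompl : ∫ p in Sᶜ, Pf p.1 * G p.2 ∂((volume : Measure (σ → ℝ)).prod volume) ≤
      (∫ p, A.indicator (fun _ => (1 : ℝ)) p.1 * Pf p.1 * G p.2 ∂((volume : Measure (σ → ℝ)).prod volume)) +
        ∫ p, Pf p.1 * (B.indicator (fun _ => (1 : ℝ)) p.2 * G p.2) ∂((volume : Measure (σ → ℝ)).prod volume) := by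
    rw [← integral_indicator hS.compl]
    have hiA : Integrable (fun p : (σ → ℝ) × Z => A.indicator (fun _ => (1 : ℝ)) p.1 * Pf p.1 * G p.2) ((volume : Measure (σ → ℝ)).prod volume) := by
      have h1 : Integrable (fun y => A.indicator (fun _ => (1 : ℝ)) y * Pf y) := by
        refine Integrable.mono' hPfi ((measurable_const.indicator hAm).mul hPfm).aestronglyMeasurable (ae_of_all _ fun y => ?_)
        rw [Real.norm_eq_abs, abs_mul, abs_of_nonneg (hPf0 y)]
        exact mul_le_of_le_one_left (hPf0 y) (by by_cases hy : y ∈ A <;> simp [hy])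
      exact h1.mul_prod hGi
    have hiB : Integrable (fun p : (σ → ℝ) × Z => Pf p.1 * (B.indicator (fun _ => (1 : ℝ)) p.2 * G p.2)) ((volume : Measure (σ → ℝ)).prod volume) := by
      have h1 : Integrable (fun z => B.indicator (fun _ => (1 : ℝ)) z * G z) := by
        refine Integrable.mono' hGi ((measurable_const.indicator hBm).mul hGm).aestronglyMeasurable (ae_of_all _ fun z => ?_)
        rw [Real.norm_eq_abs, abs_mul, abs_of_nonneg (hG0 z)]
        exact mul_le_of_le_one_left (hG0 z) (by by_cases hz : z ∈ B <;> simp [hz])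
      exact hPfi.mul_prod h1
    rw [← integral_add hiA hiB]
    refine integral_mono ((hFi.indicator hS.compl)) (hiA.add hiB) fun p => ?_
    show Sᶜ.indicator (fun p : (σ → ℝ) × Z => Pf p.1 * G p.2) p ≤ A.indicator (fun _ => (1 : ℝ)) p.1 * Pf p.1 * G p.2 + Pf p.1 * (B.indicator (fun _ => (1 : ℝ)) p.2 * G p.2)
    have hnn : 0 ≤ A.indicator (fun _ => (1 : ℝ)) p.1 * Pf p.1 * G p.2 + Pf p.1 * (B.indicator (fun _ => (1 : ℝ)) p.2 * G p.2) :=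
      add_nonneg (mul_nonneg (mul_nonneg (Set.indicator_nonneg (fun _ _ => zero_le_one) _) (hPf0 _)) (hG0 _))
        (mul_nonneg (hPf0 _) (mul_nonneg (Set.indicator_nonneg (fun _ _ => zero_le_one) _) (hG0 _)))
    by_cases hp : p ∈ Sᶜ
    · rw [Set.indicator_of_mem hp]
      rcases hgeo p hp with hA' | hB'
      · rw [Set.indicator_of_mem hA', one_mul]
        linarith [mul_nonneg (hPf0 p.1) (mul_nonneg (Set.indicator_nonneg (fun _ _ => zero_le_one) (s := B) p.2) (hG0 p.2))]
      · rw [Set.indicator_of_mem hB', one_mul]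
        linarith [mul_nonneg (mul_nonneg (Set.indicator_nonneg (fun _ _ => zero_le_one) (s := A) p.1) (hPf0 p.1)) (hG0 p.2)]
    · rw [Set.indicator_of_notMem hp]; exact hnn
  -- term A: product, completed square, translation, Chernoff
  have hA_le : ∫ p, A.indicator (fun _ => (1 : ℝ)) p.1 * Pf p.1 * G p.2 ∂((volume : Measure (σ → ℝ)).prod volume) ≤
      Real.sqrt 2 ^ Fintype.card σ * Real.exp (-(θ * (r ^ 2 / 4))) * (Λs * E) * Λg := by
    rw [integral_prod_mul (μ := (volume : Measure (σ → ℝ))) (ν := (volume : Measure Z)) (f := fun y => A.indicator (fun _ => (1 : ℝ)) y * Pf y) (g := G), hG_int]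
    refine mul_le_mul_of_nonneg_right ?_ hΛg0.le
    -- `∫ 𝟙_A Pf = E ∫ 𝟙_{A'}(u) Π e^{−s u²}` by translation `u = y − m·x`
    have e1 : ∫ y, A.indicator (fun _ => (1 : ℝ)) y * Pf y =
        E * ∫ u : σ → ℝ, {u : σ → ℝ | r ^ 2 / 4 < ∑ i, w i * u i ^ 2}.indicator (fun _ => (1 : ℝ)) u * ∏ i, Real.exp (-((a i + b i + c i) * u i ^ 2)) := by
      rw [← integral_const_mul]
      have ht := integral_sub_right_eq_self (μ := (volume : Measure (σ → ℝ)))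
        (fun u : σ → ℝ => E * ({u : σ → ℝ | r ^ 2 / 4 < ∑ i, w i * u i ^ 2}.indicator (fun _ => (1 : ℝ)) u * ∏ i, Real.exp (-((a i + b i + c i) * u i ^ 2)))) (fun i => m i * x i)
      rw [← ht]
      refine integral_congr_ae (ae_of_all _ fun y => ?_)
      show A.indicator (fun _ => (1 : ℝ)) y * Pf y =
        E * ({u : σ → ℝ | r ^ 2 / 4 < ∑ i, w i * u i ^ 2}.indicator (fun _ => (1 : ℝ)) (y - fun i => m i * x i) * ∏ i, Real.exp (-((a i + b i + c i) * (y - fun i => m i * x i) i ^ 2)))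
      have hind : A.indicator (fun _ => (1 : ℝ)) y = {u : σ → ℝ | r ^ 2 / 4 < ∑ i, w i * u i ^ 2}.indicator (fun _ => (1 : ℝ)) (y - fun i => m i * x i) := by
        by_cases hy : y ∈ A
        · rw [Set.indicator_of_mem hy, Set.indicator_of_mem (show (y - fun i => m i * x i) ∈ {u : σ → ℝ | r ^ 2 / 4 < ∑ i, w i * u i ^ 2} from by
            simpa [hAdef, Pi.sub_apply] using hy)]
        · rw [Set.indicator_of_notMem hy, Set.indicator_of_notMem (show (y - fun i => m i * x i) ∉ {u : σ → ℝ | r ^ 2 / 4 < ∑ i, w i * u i ^ 2} from by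
            simpa [hAdef, Pi.sub_apply] using hy)]
      rw [hind, hcs y]
      simp only [Pi.sub_apply]; ring
    rw [e1]
    have hch := integral_indicator_prodGauss_le (s := fun i => a i + b i + c i) (w := w) hsi hθ hθw (r ^ 2 / 4)
    calc E * ∫ u : σ → ℝ, {u : σ → ℝ | r ^ 2 / 4 < ∑ i, w i * u i ^ 2}.indicator (fun _ => (1 : ℝ)) u * ∏ i, Real.exp (-((a i + b i + c i) * u i ^ 2))
        ≤ E * (Real.sqrt 2 ^ Fintype.card σ * Real.exp (-(θ * (r ^ 2 / 4))) * ∏ i, Real.sqrt (π / (a i + b i + c i))) := mul_le_mul_of_nonneg_left hch hE0.le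
      _ = Real.sqrt 2 ^ Fintype.card σ * Real.exp (-(θ * (r ^ 2 / 4))) * (Λs * E) := by rw [hΛs]; ring
  -- term B
  have hB_le : ∫ p, Pf p.1 * (B.indicator (fun _ => (1 : ℝ)) p.2 * G p.2) ∂((volume : Measure (σ → ℝ)).prod volume) ≤
      (Λs * E) * (Real.exp (-(r ^ 2 / 4 / (2 * s ^ 2))) * (2 : ℝ) ^ ((Module.finrank ℝ Z : ℝ) / 2) * Λg) := by
    rw [integral_prod_mul (μ := (volume : Measure (σ → ℝ))) (ν := (volume : Measure Z)) (f := Pf) (g := fun z => B.indicator (fun _ => (1 : ℝ)) z * G z), hPf_int]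
    refine mul_le_mul_of_nonneg_left ?_ (by positivity)
    have h := integral_indicator_gauss_le (Z := Z) hs (r ^ 2 / 4)
    refine h.trans (le_of_eq ?_)
    rw [hΛg, Real.mul_rpow pi_pos.le (by positivity : (0:ℝ) ≤ 2 * s ^ 2), Real.mul_rpow (by norm_num : (0:ℝ) ≤ 2) (by positivity : (0:ℝ) ≤ s ^ 2),
      Real.mul_rpow pi_pos.le (by positivity : (0:ℝ) ≤ s ^ 2)]
    ring
  -- assemble: `∫_S = ∫ − ∫_{Sᶜ}`
  have hsplit := integral_add_compl hS hFi
  rw [integral_prod_mul (μ := (volume : Measure (σ → ℝ))) (ν := (volume : Measure Z)) (f := Pf) (g := G), hPf_int, hG_int] at hsplit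
  have hgoal : Λs * E * Λg - (Real.sqrt 2 ^ Fintype.card σ * Real.exp (-(θ * (r ^ 2 / 4))) * (Λs * E) * Λg +
      (Λs * E) * (Real.exp (-(r ^ 2 / 4 / (2 * s ^ 2))) * (2 : ℝ) ^ ((Module.finrank ℝ Z : ℝ) / 2) * Λg)) ≤
      ∫ p in S, Pf p.1 * G p.2 ∂((volume : Measure (σ → ℝ)).prod volume) := by linarith [hcompl.trans (add_le_add hA_le hB_le)]
  refine le_trans (le_of_eq ?_) hgoal
  rw [hΛs, hΛg, hE]; ring

end Slice

end Summit.QuantumFields.YangMills.Theorems.FemtoTransferGap.TwoLattice.ConstTube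

end
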